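import Literature.Analysis.FluidPDE.FractionalNSTorus
import HarnessLib

/-!
# Time translation of weak solutions of the fractional Navier–Stokes system on the time line

Analysis/FluidPDE proofs-only complement to `Literature.Analysis.FluidPDE.FractionalNSTorus`.
The class of Luo–Titi weak solutions on the whole time line,
`Torus.IsWeakFracNSSolutionLine α ν v` (`v ∈ C⁰_weak(ℝ; L²(T^d))` solving
`∂ₜv + div(v ⊗ v) + ∇p + ν(-Δ)^α v = 0`, `div v = 0` in `𝒟'(ℝ × T^d)`; Luo–Titi 2020, Def. 1.1),
is invariant under time translations `v ↦ v(· + s)`: the system is autonomous, the test class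
(smooth divergence-free fields with compact support in time) is translation invariant, and
Lebesgue measure on `ℝ` is translation invariant. This is the (folklore) remark by which the
compactly supported weak solutions of Luo–Titi's Theorem 1 are moved to have "initial values
zero" ("in particular, there are infinitely many weak solutions with initial values zero",
Luo–Titi 2020, §1 Theorem 1); it is used in
`Literature/Barriers/NavierStokesRegularity/LionsExponentSharpnessProofs.lean`.

## Contents (all proved)

* `Torus.stLift_comp_add_right`, `Torus.measurePreserving_prodMap_add_right`: the space–time
  lift of `v(· + s)` is the lift of `v` composed with the measure-preserving shear
  `(t, y) ↦ (t + s, y)` of `ℝ × ℝ^d`;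
* `Torus.timeDeriv_comp_add_right` / `Torus.timeDeriv_comp_sub_right`: `∂ₜ[ψ(· ± s)] = (∂ₜψ)(· ± s)`;
* `Torus.IsWeakFracNSSolutionLine.comp_add_right`: if `v` is a weak solution on the line, so is
  `fun t ↦ v (t + s)`, for every `s : ℝ`.

## References

* T. Luo, E. S. Titi, *Non-uniqueness of weak solutions to hyperviscous Navier–Stokes equations:
  on sharpness of J.-L. Lions exponent*, Calc. Var. PDE 59 (2020), Paper 92 = arXiv:1808.07595,
  §1, Def. 1.1 and Theorem 1. [`LuoTiti2020`]
-/

noncomputable section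

open MeasureTheory Set Filter Topology
open scoped ENNReal InnerProductSpace ContDiff

namespace Literature.Analysis.FluidPDE

namespace Torus

variable {d : Type*} [Fintype d]
variable {F : Type*} [NormedAddCommGroup F] [NormedSpace ℝ F]

/-! ## Time shears of space–time -/

omit [Fintype d] [NormedAddCommGroup F] [NormedSpace ℝ F] in
/-- The space–time lift of the time translate `t ↦ v (t + s)` is the lift of `v` composed with
the shear `(t, y) ↦ (t + s, y)`. [folklore] -/
theorem stLift_comp_add_right (v : ℝ → UnitAddTorus d → F) (s : ℝ) :
    FunctionSpaces.Torus.stLift (fun t => v (t + s)) = FunctionSpaces.Torus.stLift v ∘ Prod.map (fun t : ℝ => t + s) id := by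
  funext p
  rfl

/-- The time shear `(t, y) ↦ (t + s, y)` of `ℝ × ℝ^d` is smooth. [folklore] -/
theorem contDiff_prodMap_add_right (s : ℝ) :
    ContDiff ℝ ∞ (Prod.map (fun t : ℝ => t + s) (id : EuclideanSpace ℝ d → EuclideanSpace ℝ d)) :=
  (contDiff_id.add contDiff_const).prodMap contDiff_id

/-- The time shear `(t, y) ↦ (t + s, y)` preserves Lebesgue measure on `ℝ × ℝ^d`
(translation invariance of Lebesgue measure on `ℝ`). [folklore] -/
theorem measurePreserving_prodMap_add_right (s : ℝ) :
    MeasurePreserving (Prod.map (fun t : ℝ => t + s) (id : EuclideanSpace ℝ d → EuclideanSpace ℝ d))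
      volume volume :=
  (measurePreserving_add_right volume s).prod (MeasurePreserving.id volume)

omit [Fintype d] in
/-- `∂ₜ[ψ(· + s)](t, x) = (∂ₜψ)(t + s, x)`. [folklore] -/
theorem timeDeriv_comp_add_right (ψ : ℝ → UnitAddTorus d → F) (s t : ℝ) (x : UnitAddTorus d) :
    FunctionSpaces.Torus.timeDeriv (fun τ => ψ (τ + s)) t x = FunctionSpaces.Torus.timeDeriv ψ (t + s) x := by
  simp only [FunctionSpaces.Torus.timeDeriv]
  exact deriv_comp_add_const (fun τ => ψ τ x) s t

omit [Fintype d] in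
/-- `∂ₜ[ψ(· - s)](t, x) = (∂ₜψ)(t - s, x)`. [folklore] -/
theorem timeDeriv_comp_sub_right (ψ : ℝ → UnitAddTorus d → F) (s t : ℝ) (x : UnitAddTorus d) :
    FunctionSpaces.Torus.timeDeriv (fun τ => ψ (τ - s)) t x = FunctionSpaces.Torus.timeDeriv ψ (t - s) x := by
  simp only [FunctionSpaces.Torus.timeDeriv]
  exact deriv_comp_sub_const (fun τ => ψ τ x) s t

/-! ## Translation invariance of the class of weak solutions on the line -/

variable [DecidableEq d]

/-- **Time-translation invariance of Luo–Titi weak solutions.** If `v ∈ C⁰_weak(ℝ; L²(T^d))`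
is a weak solution of the fractional Navier–Stokes system on the whole time line
(`Torus.IsWeakFracNSSolutionLine`, Luo–Titi 2020, Def. 1.1), then so is its time translate
`t ↦ v (t + s)` for every `s : ℝ`: measurability of the lift is transported along the
measure-preserving shear `(t, y) ↦ (t + s, y)`; the slice conditions (`L²`, weak continuity,
weak incompressibility) are pointwise in time; and the weak momentum identity against a test
field `ψ` for the translate is the identity for `v` against the translated test field
`ψ(· - s)` (again smooth, compactly supported in time and divergence free) after the change of
variables `t ↦ t + s` in the time integral (`MeasureTheory.integral_add_right_eq_self`). This is
the step "in particular, there are infinitely many weak solutions with initial values zero" of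
Luo–Titi's Theorem 1 (the system (1.1) is autonomous). [cite: LuoTiti2020, §1 Def. 1.1 and Theorem 1] -/
theorem IsWeakFracNSSolutionLine.comp_add_right {α ν : ℝ}
    {v : ℝ → UnitAddTorus d → EuclideanSpace ℝ d} (h : IsWeakFracNSSolutionLine α ν v) (s : ℝ) :
    IsWeakFracNSSolutionLine α ν (fun t => v (t + s)) := by
  obtain ⟨hmeas, hL2, hcont, hdiv, hweak⟩ := h
  refine ⟨?_, fun t => hL2 (t + s), fun φ hφ => (hcont φ hφ).comp (continuous_add_const s),
    fun t => hdiv (t + s), fun ψ hψs hψc hψd => ?_⟩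
  · -- measurability of the lift
    rw [stLift_comp_add_right]
    exact hmeas.comp_measurePreserving (measurePreserving_prodMap_add_right s)
  · -- the weak identity: test `v` against the translated field `ψ' = ψ(· - s)`
    obtain ⟨a, b, hab⟩ := hψc
    set ψ' : ℝ → UnitAddTorus d → EuclideanSpace ℝ d := fun t => ψ (t - s) with hψ'_def
    have hψ's : ContDiff ℝ ∞ (FunctionSpaces.Torus.stLift ψ') := by
      have hcomp : FunctionSpaces.Torus.stLift ψ' = FunctionSpaces.Torus.stLift ψ ∘ Prod.map (fun t : ℝ => t + -s) id := by
        funext p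
        simp only [hψ'_def, FunctionSpaces.Torus.stLift, Function.comp_apply, Prod.map_fst, Prod.map_snd, id,
          sub_eq_add_neg]
      rw [hcomp]
      exact hψs.comp (contDiff_prodMap_add_right (-s))
    have hψ'c : ∃ a' b' : ℝ, ∀ t, t ∉ Icc a' b' → ψ' t = 0 := by
      refine ⟨a + s, b + s, fun t ht => hab (t - s) ?_⟩
      intro hts
      exact ht ⟨by linarith [hts.1], by linarith [hts.2]⟩
    have hψ'd : FunctionSpaces.Torus.IsDivFreeTest ψ' := fun t => hψd (t - s)
    have hid := hweak ψ' hψ's hψ'c hψ'd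
    -- change of variables `t ↦ t + s` in the time integral
    set G : ℝ → ℝ := fun t => ∫ x, (⟪v t x, FunctionSpaces.Torus.timeDeriv ψ' t x⟫_ℝ +
      ⟪v t x, FunctionSpaces.Torus.convect (v t) (ψ' t) x⟫_ℝ - ν * ⟪v t x, fracLaplacian α (ψ' t) x⟫_ℝ) with hG_def
    have hshift : ∫ t, G (t + s) = ∫ t, G t := integral_add_right_eq_self G s
    have hG : ∀ t, G (t + s) = ∫ x, (⟪v (t + s) x, FunctionSpaces.Torus.timeDeriv ψ t x⟫_ℝ +
        ⟪v (t + s) x, FunctionSpaces.Torus.convect (v (t + s)) (ψ t) x⟫_ℝ -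
          ν * ⟪v (t + s) x, fracLaplacian α (ψ t) x⟫_ℝ) := by
      intro t
      have h1 : ∀ x, FunctionSpaces.Torus.timeDeriv ψ' (t + s) x = FunctionSpaces.Torus.timeDeriv ψ t x := fun x => by
        rw [hψ'_def, timeDeriv_comp_sub_right, add_sub_cancel_right]
      have h2 : ψ' (t + s) = ψ t := by
        simp only [hψ'_def, add_sub_cancel_right]
      simp only [hG_def, h1, h2]
    calc ∫ t, ∫ x, (⟪v (t + s) x, FunctionSpaces.Torus.timeDeriv ψ t x⟫_ℝ +
          ⟪v (t + s) x, FunctionSpaces.Torus.convect (v (t + s)) (ψ t) x⟫_ℝ -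
            ν * ⟪v (t + s) x, fracLaplacian α (ψ t) x⟫_ℝ)
        = ∫ t, G (t + s) := integral_congr_ae (ae_of_all _ fun t => (hG t).symm)
      _ = ∫ t, G t := hshift
      _ = 0 := hid

/-- Time translation in the other direction: `t ↦ v (t - s)` is again a weak solution on the
line. [folklore] -/
theorem IsWeakFracNSSolutionLine.comp_sub_right {α ν : ℝ}
    {v : ℝ → UnitAddTorus d → EuclideanSpace ℝ d} (h : IsWeakFracNSSolutionLine α ν v) (s : ℝ) :
    IsWeakFracNSSolutionLine α ν (fun t => v (t - s)) := by
  simpa only [sub_eq_add_neg] using h.comp_add_right (-s)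

end Torus

end Literature.Analysis.FluidPDE
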